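import Mathlib
import HarnessLib

/-!
# courier split of the staged transcript `OSWMechanismCurvatureIdentity.lean` — part 01 of 01

1-D model (gCLM/OSW), computer-assisted; not Euler/NS.  Filed under `Summits/NavierStokesRegularity/OSWSelfSimilar/` by a prover-role courier on behalf of the
mechanism seat pub-oswblow-mech (planner-pub-oswblow-mech-g30-0), cell pub-oswblow (host summit NavierStokesRegularity); the gate admits the path but
not role planner.  CONTENT = the staged transcript `pub-oswblow-mech/lean/OSWMechanismCurvatureIdentity.lean` (sha256 cd5ee08165abf387…,
216 lines), source lines 20–216, UNCHANGED except: (i) namespace prefix `OSWSelfSimilar.Mechanism` → `Summit.NavierStokesRegularity.OSWSelfSimilar.Mechanism`;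
(ii) [parts >= 02 only: the frames open at the cut are re-opened above the body and closed at the end; nothing to re-open here]
(iii) this docstring and, below it, the transcript's own module documentation VERBATIM (renamed).  Generated by `pub-oswblow-mech/lean/courier/make_split.py`; the parts must be filed IN ORDER
(each imports its predecessor).  First/last declarations here: `curvature_identity` … `u2_pos_of_polygon` (19 in this part).
AI-written transcript; kernel-checked on the farm as ONE file before splitting (see the kit's CHECKS); to be checked, not trusted.
COURIER NOTE (prover-role courier seat pub-oswblow-courier g2, 2026-08-25): in addition to the changes listed above, 2 one-line docstrings were added at filing on the declarations the transcript left undocumented (tree docstring rule); each only restates the formal statement of its declaration; nothing else was touched. List of the added docstrings: HOME `pub-oswblow-courier/g2/DOCSTRINGS.tsv`.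
-/

/-!
# OSW self-similar mechanism — the c-curvature identity (MECHANISM §35.14, v30c)

1-D model (gCLM/OSW), computer-assisted; not Euler/NS.  AI-written; to be checked, not trusted.
Staged companion file (NOT filed in the tree; no axiom, no sorry).

With `c = 1 - cos x`, `' = d/dc`, `s2 = sin² x = c (2 - c)`, `G = g / sin x`, `u = F / sin x`,
`h = s2 G' + (1 - c) G` (strain) and the transport defect `χ = h - 1 - a (1 - c) G`
(q₀ = 1 normalisation), the transport identity reads `a s2 G u' = u χ` (hypothesis `H1`) and its
c-derivative is `H2`.  PROPOSITION 35.13: `(a s2 G)² u'' = u · 𝒬`,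
`𝒬 = Q₀ + a s2² G G''`, `Q₀ = (1 - h)(1 - (1 - a) h) + 3 a (1 - c) G - a (1 - a)(1 + 2 (1 - c)²) G²`.
Here `u1, u2, G1, G2` stand for `u', u'', G', G''` at one point: the statement is the pointwise
polynomial identity, kernel-checked by `linear_combination`.
Also checked: the sink value `Q₀(c = 2) = a B (1 + (1 - a) B)(p - 3)` with `p = (1 + B)/(a B)`
(COROLLARY 35.14), and the vertex factorisations used in LEMMA 35.16.
-/

namespace Summit.NavierStokesRegularity.OSWSelfSimilar.Mechanism.CurvatureIdentity

/-- PROPOSITION 35.13 (pointwise polynomial form). -/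
theorem curvature_identity
    (a c u u1 u2 G G1 G2 : ℝ)
    (H1 : a * (c * (2 - c)) * G * u1
          = u * ((c * (2 - c)) * G1 + (1 - c) * G - 1 - a * (1 - c) * G))
    (H2 : a * (((c * (2 - c)) * G1 + (1 - c) * G) + (1 - c) * G) * u1
            + a * (c * (2 - c)) * G * u2
          = u1 * ((c * (2 - c)) * G1 + (1 - c) * G - 1 - a * (1 - c) * G)
            + u * (((c * (2 - c)) * G2 + (2 - 2 * c) * G1)
                    + (1 - a) * ((1 - c) * G1 - G))) :
    (a * (c * (2 - c)) * G) ^ 2 * u2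
      = u * ( (1 - ((c * (2 - c)) * G1 + (1 - c) * G))
                * (1 - (1 - a) * ((c * (2 - c)) * G1 + (1 - c) * G))
              + 3 * a * (1 - c) * G
              - a * (1 - a) * (1 + 2 * (1 - c) ^ 2) * G ^ 2
              + a * (c * (2 - c)) ^ 2 * G * G2 ) := by
  linear_combination
    (((c * (2 - c)) * G1 + (1 - c) * G - 1 - a * (1 - c) * G)
        - a * (((c * (2 - c)) * G1 + (1 - c) * G) + (1 - c) * G)) * H1
    + (a * (c * (2 - c)) * G) * H2

/-- The local part `Q₀` as a function of `(h, G, κ)` with `κ = cos x = 1 - c`. -/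
noncomputable def Q0 (a h G κ : ℝ) : ℝ :=
  (1 - h) * (1 - (1 - a) * h) + 3 * a * κ * G - a * (1 - a) * (1 + 2 * κ ^ 2) * G ^ 2

/-- COROLLARY 35.14 (sink value): at `c = 2` (`κ = -1`, `h = -B`, `G = B`) one has
`Q₀ = a B (1 + (1 - a) B) (p - 3)` with `p = (1 + B)/(a B)`, written without division. -/
theorem Q0_sink (a B : ℝ) :
    Q0 a (-B) B (-1) = (1 + (1 - a) * B) * ((1 + B) - 3 * a * B) := by
  unfold Q0; ring

/-- Source value: at `c = 0` (`κ = 1`, `h = G = A = 1/(1-a)`), `Q₀ = 0` (q₀ = 1 normalisation). -/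
theorem Q0_source (a A : ℝ) (hA : (1 - a) * A = 1) :
    Q0 a A A 1 = 0 := by
  unfold Q0
  have h1 : 1 - (1 - a) * A = 0 := by linarith
  have h3a : 3 * a * 1 * A - a * (1 - a) * (1 + 2 * (1:ℝ) ^ 2) * A ^ 2 = 0 := by
    have : a * (1 - a) * (1 + 2 * (1:ℝ) ^ 2) * A ^ 2 = 3 * a * A * ((1 - a) * A) := by ring
    rw [this, hA]; ring
  calc (1 - A) * (1 - (1 - a) * A) + 3 * a * 1 * A - a * (1 - a) * (1 + 2 * (1:ℝ) ^ 2) * A ^ 2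
      = (1 - A) * (1 - (1 - a) * A) + (3 * a * 1 * A - a * (1 - a) * (1 + 2 * (1:ℝ) ^ 2) * A ^ 2) := by
        ring
    _ = 0 := by rw [h1, h3a]; ring

/-! ### LEMMA 35.16 bookkeeping: normalised vertex polynomials of the 1-jet triangle.
`Φ(η, t; κ) = A η² - (A+1) η + 1 - (A-1)(1+2κ²) t² + 3 (A-1) κ t` is `Q₀` in the variables
`η = h/A`, `t = G/A` (times 1, using `a = (A-1)/A`). -/

/-- The normalised vertex polynomial of LEMMA 35.16: `Φ(A, η, t; κ) = Aη² − (A+1)η + 1 − (A−1)(1+2κ²)t² + 3(A−1)κt` (`= Q₀` in `η = h/A`, `t = G/A`). -/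
noncomputable def Phi (A η t κ : ℝ) : ℝ :=
  A * η ^ 2 - (A + 1) * η + 1 - (A - 1) * (1 + 2 * κ ^ 2) * t ^ 2 + 3 * (A - 1) * κ * t

/-- `Q₀ = Φ` after normalisation (`h = A η`, `G = A t`, `a = 1 - 1/A`). -/
theorem Q0_eq_Phi (A η t κ : ℝ) (hA : A ≠ 0) :
    Q0 (1 - 1 / A) (A * η) (A * t) κ = Phi A η t κ := by
  unfold Q0 Phi
  field_simp
  ring

/-- Vertex V3 = (t, η) = (b, κ b):  `Φ = 1 + 2(A-2) κ b - (A-1) b² - (A-2) κ² b²`. -/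
theorem Phi_V3 (A b κ : ℝ) :
    Phi A (κ * b) b κ = 1 + 2 * (A - 2) * κ * b - (A - 1) * b ^ 2 - (A - 2) * κ ^ 2 * b ^ 2 := by
  unfold Phi; ring

/-- V3 at the two ends `κ = ∓1`: the `p ≥ 3` factor `(1+b)(1-(2A-3)b)` and `(1-b)(1+(2A-3)b)`. -/
theorem Phi_V3_ends (A b : ℝ) :
    Phi A (-b) b (-1) = (1 + b) * (1 - (2 * A - 3) * b)
    ∧ Phi A b b 1 = (1 - b) * (1 + (2 * A - 3) * b) := by
  unfold Phi; constructor <;> ring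

/-- Vertex V1 (G affine = chord): `t = 1 - (1-b)(1-κ)/2`, `η = (2κ-1) t + (1-κ) b`;
`Φ = (1-κ)² W(κ)` with `W` the explicit convex quadratic below. -/
theorem Phi_V1 (A b κ : ℝ) :
    Phi A ((2 * κ - 1) * (1 - (1 - b) * (1 - κ) / 2) + (1 - κ) * b) (1 - (1 - b) * (1 - κ) / 2) κ
      = (1 - κ) ^ 2 * ( (A + 1) * (1 - b) ^ 2 / 2 * κ ^ 2 + (1 - b) * (A * (1 - b) + 2) * κ
                        + (b ^ 2 / 4 - 3 * A * b / 2 + A / 2 + 7 / 4) ) := by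
  unfold Phi; ring

/-- `W(-1) = (1+b)(1-(2A-3)b)/4`. -/
theorem W_at_neg_one (A b : ℝ) :
    (A + 1) * (1 - b) ^ 2 / 2 * (-1:ℝ) ^ 2 + (1 - b) * (A * (1 - b) + 2) * (-1)
      + (b ^ 2 / 4 - 3 * A * b / 2 + A / 2 + 7 / 4)
      = (1 + b) * (1 - (2 * A - 3) * b) / 4 := by
  ring

/-- Edge quadratics in `t`: leading coefficients (E_lo: `η = (1+2κ)t-(1+κ)`; E_hi: `η = (2κ-1)t+(1-κ)b`). -/
theorem Phi_Elo (A κ t : ℝ) :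
    Phi A ((1 + 2 * κ) * t - (1 + κ)) t κ
      = ((2 * A + 2) * κ ^ 2 + 4 * A * κ + 1) * t ^ 2
        - (4 * A * κ ^ 2 + 5 * (A + 1) * κ + 3 * A + 1) * t
        + (A * κ ^ 2 + (3 * A + 1) * κ + 2 * A + 2) := by
  unfold Phi; ring

/-- Edge quadratic in `t` on E_hi (`η = (2κ−1)t + (1−κ)b`): `Φ` expanded as an explicit quadratic polynomial in `t`. -/
theorem Phi_Ehi (A b κ t : ℝ) :
    Phi A ((2 * κ - 1) * t + (1 - κ) * b) t κ
      = ((2 * A + 2) * κ ^ 2 - 4 * A * κ + 1) * t ^ 2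
        + (-(4 * A * b) * κ ^ 2 + (6 * A * b + A - 5) * κ + (A + 1 - 2 * A * b)) * t
        + (A * b ^ 2 * κ ^ 2 + (A * b - 2 * A * b ^ 2 + b) * κ + (A * b ^ 2 - A * b - b + 1)) := by
  unfold Phi; ring

/-- E_lo: `-c₁ - 2 c₂ = -(4κ² + (3A-5)κ + 1 - 3A) = (1-κ)(4κ + 3A - 1)`; nonnegative on `κ ≤ 1`
when `4κ + 3A - 1 ≥ 0` (e.g. `κ ≥ -1`, `A ≥ 5/3`): the vertex of the edge parabola lies at `t ≥ 1`. -/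
theorem Elo_vertex_factor (A κ : ℝ) :
    (4 * A * κ ^ 2 + 5 * (A + 1) * κ + 3 * A + 1) - 2 * ((2 * A + 2) * κ ^ 2 + 4 * A * κ + 1)
      = (1 - κ) * (4 * κ + 3 * A - 1) := by
  ring

/-! ### LEMMA 35.18: the source curvature of the rays in closed form.
`k_L(0) = (2/(15π)) ∫_L^π (1+cos t)²(3−2cos t)/(1−cos t) dt = (2/(15π))(4cot(L/2) − 3 sin L − sin L cos L)
 = 8cos⁵(L/2)/(15π sin(L/2))`. -/

/-- Polynomial division behind the antiderivative: `(1+y)²(3−2y) = (1−y)(2y²+3y−1) + 4`. -/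
theorem ray_source_integrand (y : ℝ) :
    (1 + y) ^ 2 * (3 - 2 * y) = (1 - y) * (2 * y ^ 2 + 3 * y - 1) + 4 := by
  ring

/-- Half-angle closed form: with `s = sin(L/2) ≠ 0`, `C = cos(L/2)`, `sin L = 2sC`, `cos L = 2C² − 1`:
`4C/s − 3·(2sC) − (2sC)(2C²−1) = 4C⁵/s`. -/
theorem ray_source_closed_form (s C : ℝ) (hs : s ≠ 0) (h : s ^ 2 + C ^ 2 = 1) :
    4 * C / s - 3 * (2 * s * C) - (2 * s * C) * (2 * C ^ 2 - 1) = 4 * C ^ 5 / s := by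
  rw [div_sub' (hc := hs), div_sub' (hc := hs), div_eq_div_iff hs hs]
  have h' : s ^ 2 = 1 - C ^ 2 := by linarith
  have e : (4 * C - s * (3 * (2 * s * C)) - s * (2 * s * C * (2 * C ^ 2 - 1))) = 4 * C ^ 5 := by
    have : (4 * C - s * (3 * (2 * s * C)) - s * (2 * s * C * (2 * C ^ 2 - 1)))
        = 4 * C - 4 * (s ^ 2) * C - 4 * (s ^ 2) * C ^ 3 := by ring
    rw [this, h']; ring
  rw [e]

/-- LEMMA 35.18 (sign): `8cos⁵(L/2)/(15π·sin(L/2)) > 0` for `0 < L < π`. -/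
theorem ray_source_pos (L : ℝ) (h0 : 0 < L) (h1 : L < Real.pi) :
    0 < 8 * Real.cos (L / 2) ^ 5 / (15 * Real.pi * Real.sin (L / 2)) := by
  have hc : 0 < Real.cos (L / 2) := by
    apply Real.cos_pos_of_mem_Ioo
    constructor <;> linarith [Real.pi_pos]
  have hs : 0 < Real.sin (L / 2) := by
    apply Real.sin_pos_of_pos_of_lt_pi <;> linarith
  have hpi : 0 < Real.pi := Real.pi_pos
  positivity

/-! ### LEMMA 35.15 typed, and the pointwise core of THEOREM M44 proved relative to it. -/

/-- The threshold `a_* = 1 − 4/(3+√33) ≈ 0.5426` (`A_* = (3+√33)/4`). -/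
noncomputable def aStar : ℝ := 1 - 4 / (3 + Real.sqrt 33)

/-- LEMMA 35.15 (THE POLYGON INEQUALITY, typed; proved pen-and-paper in MECHANISM §35.15):
for `a_* ≤ a < 1`, `0 < B < A₀ = 1/(1−a)`, `(3a−1)B ≤ 1` (⟺ `p ≥ 3`), `0 < c < 2`, and a 1-jet `(G, m)`
with `B ≤ G ≤ A₀ − (A₀−B)c/2`, `(G−A₀)/c ≤ m ≤ 0`, `m(2−c) ≤ B − G`, the local term is positive:
`Q₀(c(2−c)m + (1−c)G, G, 1−c) > 0`. -/
def PolygonInequality : Prop :=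
  ∀ a B c G m : ℝ, aStar ≤ a → a < 1 → 0 < B → B < 1 / (1 - a) → (3 * a - 1) * B ≤ 1 →
    0 < c → c < 2 → B ≤ G → G ≤ 1 / (1 - a) - (1 / (1 - a) - B) * c / 2 →
    (G - 1 / (1 - a)) / c ≤ m → m ≤ 0 → m * (2 - c) ≤ B - G →
    0 < Q0 a (c * (2 - c) * m + (1 - c) * G) G (1 - c)

/-- THEOREM M44, pointwise core (PROVED in Lean relative to `PolygonInequality`): at a point where the
transport identity (35.16a) and its c-derivative hold, the jet of `G` obeys (35.18), `u, G > 0` and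
`G'' ≥ 0`, one has `u'' > 0`.  (`0 < a` is implied by `a_* ≤ a` but assumed explicitly.) -/
theorem u2_pos_of_polygon (hP : PolygonInequality)
    (a B c u u1 u2 G G1 G2 : ℝ)
    (ha0 : 0 < a) (ha : aStar ≤ a) (ha1 : a < 1) (hB : 0 < B) (hBA : B < 1 / (1 - a))
    (hp : (3 * a - 1) * B ≤ 1) (hc : 0 < c) (hc2 : c < 2)
    (hGB : B ≤ G) (hGch : G ≤ 1 / (1 - a) - (1 / (1 - a) - B) * c / 2)
    (hm1 : (G - 1 / (1 - a)) / c ≤ G1) (hm0 : G1 ≤ 0) (hm2 : G1 * (2 - c) ≤ B - G)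
    (hu : 0 < u) (hG2 : 0 ≤ G2)
    (H1 : a * (c * (2 - c)) * G * u1
          = u * ((c * (2 - c)) * G1 + (1 - c) * G - 1 - a * (1 - c) * G))
    (H2 : a * (((c * (2 - c)) * G1 + (1 - c) * G) + (1 - c) * G) * u1
            + a * (c * (2 - c)) * G * u2
          = u1 * ((c * (2 - c)) * G1 + (1 - c) * G - 1 - a * (1 - c) * G)
            + u * (((c * (2 - c)) * G2 + (2 - 2 * c) * G1)
                    + (1 - a) * ((1 - c) * G1 - G))) :
    0 < u2 := by
  have hG : 0 < G := lt_of_lt_of_le hB hGB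
  have hQ0 : 0 < Q0 a (c * (2 - c) * G1 + (1 - c) * G) G (1 - c) :=
    hP a B c G G1 ha ha1 hB hBA hp hc hc2 hGB hGch hm1 hm0 hm2
  have hid := curvature_identity a c u u1 u2 G G1 G2 H1 H2
  simp only [Q0] at hQ0
  have h2c : 0 < 2 - c := by linarith
  have hX : 0 < a * (c * (2 - c)) * G := by positivity
  have hX2 : 0 < (a * (c * (2 - c)) * G) ^ 2 := by positivity
  have hT3 : 0 ≤ a * (c * (2 - c)) ^ 2 * G * G2 := by positivity
  have hR : 0 < u * ( (1 - ((c * (2 - c)) * G1 + (1 - c) * G))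
                * (1 - (1 - a) * ((c * (2 - c)) * G1 + (1 - c) * G))
              + 3 * a * (1 - c) * G
              - a * (1 - a) * (1 + 2 * (1 - c) ^ 2) * G ^ 2
              + a * (c * (2 - c)) ^ 2 * G * G2 ) := by
    apply mul_pos hu
    linarith
  rw [← hid] at hR
  by_contra hneg
  have hneg' : u2 ≤ 0 := not_lt.mp hneg
  have : (a * (c * (2 - c)) * G) ^ 2 * u2 ≤ 0 :=
    mul_nonpos_of_nonneg_of_nonpos hX2.le hneg'
  linarith

end Summit.NavierStokesRegularity.OSWSelfSimilar.Mechanism.CurvatureIdentity
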